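import Summits.QuantumFields.YangMills.Theorems.BalabanLadderIRAbstractBasinRung
import Summits.QuantumFields.YangMills.Theorems.BalabanLadderIRDefectSquaringSharpExtension
import HarnessLib

/-!
# The abstract purity basin from `2⁻⁸`: sharp spatial extension `(8/3)³` + sharp excess (seed of the `IR` bill at ONE tolerance `2⁻⁸`)

HONEST FRAMING.  Nothing here proves the Yang–Mills mass gap (Clay), a lattice gap, the crux `BalabanLadder.IR` (stmt-QuantumFields-19354) or its
seed; `R4` closes only the conditional finite-𝕋⁴ rung `BalabanLadder.UV`.  Sorry-free POSITIVE GLUE over tree names (helper for item 19354, line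
`basin-transfer` of ideator ym-ir-idea-9, shortlisted #1 by the joint critics' R388 round-1 list 2026-08-28; RULING director-ym g9-№2): model-free
reflection-positivity bookkeeping valid for every compact gauge group at every `β ≥ 0`.  All Yang–Mills content stays in the hypotheses
`ColdExitAt (1/2^8)`, `AFToColdPressure`, `IRnsc`.

CONTENT.  The landed rung `abstractBasin_two_pow_9` (this namespace) used the tower extension `extension_le` (`27 = (3/2·2)³` per exact doubling).
Replacing it by the landed SHARP EXTENSION `AspectBootstrap.cube_extension_sharp` (ideator ym-ir-idea-13, `Y_c(L') ≤ (L'/(L−c))³ Y_c(L)`; at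
`c = ⌊L/4⌋`, `L' = 2L`: `(8/3)³ = 512/27 ≈ 18.96`) and keeping the sharp excess bound `exc_le_sharp` (`exc ≈ δ/2`) gives, for `δ = δ(L) ≤ 2⁻⁸`,
`δ(2L) ≤ 2 (9.64 δ e^{9.64 δ})² ≤ 201 u²` (`δ ≤ u ≤ 2⁻⁸`): contracting below `≈ 1/201 ≈ 2^{-7.65}`.  Two doublings take `2⁻⁸` to `2⁻⁹`, and the landed
rung takes `2⁻⁹` to `ε⋆ = 2⁻²⁴`:
* `abstractBasin_two_pow_8 : AbstractBasin (1/2^8) (1/2^9)`, `abstractBasin_two_pow_8_epsStar : AbstractBasin (1/2^8) epsStar`;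
* `IR_of_exitAt8 : ColdExitAt (1/2^8) → AFToColdPressure → IRnsc → BalabanLadder.IR` — the bill of record re-based on a seed at ONE tolerance
  `2⁻⁸ ≈ 0.4 %` at ONE cold `4:1` torus (SU(2), β_W = 2.4, glueball-gas synthesis: witness side `≈ 48a`).
The volume-bounds hypothesis `[Vol]` is not used by this step (the sharp extension needs none); it stays in `AbstractBasin` for uniformity.
CEILING (honest, unchanged): the volume law `Y(2L-box) ≈ 8 Y(L-box)` caps pure squaring bookkeeping at the fixed point `≈ 1/32`; the open stub of line
`basin-transfer` is `AbstractBasin (1/2^6) (1/2^9)`.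

Sources: tree `AspectBootstrap.cube_extension_sharp`, `defect_facts`, `exc_two_mul_le_sq`, `exc_eq_exp_Yfun`, `BasinRung.exc_le_sharp`,
`BasinRung.abstractBasin_two_pow_9`, `BasinRung.IR_of_exitAt9`; Knabe1988, GossetMozgunov2016, LemmSandvikWang2020 (arXiv:1910.11810) for the
threshold-raising pattern.
-/

set_option autoImplicit false

noncomputable section

open MeasureTheory Filter Topology
open Literature.MathematicalPhysics.QuantumFieldTheory Literature.MathematicalPhysics.QuantumLattice
open Summit.QuantumFields.YangMills.Cruxes.IR.ColdPressurePincer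
open Summit.QuantumFields.YangMills.Cruxes.IR.ColdPurityBridge
open Summit.QuantumFields.YangMills.Cruxes.IR.AspectBootstrap

namespace Summit.QuantumFields.YangMills.Cruxes.IR.BasinRung

/-! ## §1 Basins compose -/

/-- Basins compose: `AbstractBasin θ ε₁ → AbstractBasin ε₁ ε₂ → AbstractBasin θ ε₂`. -/
theorem abstractBasin_trans {θ ε₁ ε₂ : ℝ} (h₁ : AbstractBasin θ ε₁) (h₂ : AbstractBasin ε₁ ε₂) : AbstractBasin θ ε₂ := by
  intro Z hS hT hV L hL hδ
  obtain ⟨L₁, hL₁, hδ₁⟩ := h₁ Z hS hT hV L hL hδ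
  exact h₂ Z hS hT hV L₁ hL₁ hδ₁

section Rung8
variable {Z : ℕ → ℕ → ℕ → ℕ → ℝ}

/-- **Sharp squaring at exact doubling with the sharp extension**: for `L ≥ 8` and `δ = boxDefect Z L ≤ 2⁻⁸`:
`boxDefect Z (2L) ≤ 2 (9.64 δ e^{9.64 δ})²` (constant `(512/27)·(1+2δ)²/2 ≤ 9.64`; no volume bounds needed). -/
theorem defectSquaring_double_sharp8 (hS : IsAxisSymmetric Z) (hT : IsTracePositive Z)
    (L : ℕ) (hL : 8 ≤ L) (hsmall : boxDefect Z L ≤ 1 / 2 ^ 8) :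
    boxDefect Z (2 * L) ≤ 2 * (9.64 * boxDefect Z L * Real.exp (9.64 * boxDefect Z L)) ^ 2 := by
  set L' := 2 * L with hL'def
  obtain ⟨k, hk⟩ : ∃ k, L / 4 = k + 2 := ⟨L / 4 - 2, by omega⟩
  obtain ⟨k', hk'⟩ : ∃ k', L' / 4 = k' + 2 := ⟨L' / 4 - 2, by omega⟩
  have hkk' : 2 * k + 2 ≤ k' := by omega
  have h4k : 4 * (k + 2) ≤ L := by omega
  have hLL' : L ≤ L' := by omega
  have hL2 : 2 ≤ L := by omega
  have hL'2 : 2 ≤ L' := by omega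
  have hz : HasSpectralDatum (Z L L L) := hT L L L hL2 hL2 hL2
  have hz' : HasSpectralDatum (Z L' L' L') := hT L' L' L' hL'2 hL'2 hL'2
  simp only [boxDefect, hk] at hsmall
  simp only [boxDefect, hk, hk']
  obtain ⟨hδ0, -, -, -⟩ := defect_facts hz k
  obtain ⟨-, hδ'1, hδ'x, -⟩ := defect_facts hz' k'
  set δ : ℝ := 1 - Z L L L (2 * (k + 2)) / Z L L L (k + 2) ^ 2 with hδdef
  set δ' : ℝ := 1 - Z L' L' L' (2 * (k' + 2)) / Z L' L' L' (k' + 2) ^ 2 with hδ'def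
  have hhalf : δ ≤ 1 / 2 := hsmall.trans (by norm_num)
  have hx : exc (Z L L L) (k + 2) ≤ δ * (1 + 2 * δ) ^ 2 / 2 := exc_le_sharp hz k hhalf le_rfl
  have hc : δ * (1 + 2 * δ) ^ 2 / 2 ≤ 9.64 / (512 / 27) * δ := by
    have h1 : (1 + 2 * δ) ^ 2 ≤ (1 + 2 * (1 / 2 ^ 8 : ℝ)) ^ 2 :=
      pow_le_pow_left₀ (by linarith) (by linarith) 2
    have h2 : (1 + 2 * (1 / 2 ^ 8 : ℝ)) ^ 2 ≤ 2 * (9.64 / (512 / 27)) := by norm_num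
    nlinarith
  have hy : Yfun (Z L L L) (k + 2) ≤ 9.64 / (512 / 27) * δ := ((Yfun_le_exc hz k).trans hx).trans hc
  have hy0 : 0 ≤ Yfun (Z L L L) (k + 2) := Yfun_nonneg hz k
  -- the sharp cube extension at `c = k+2 = ⌊L/4⌋`, `L' = 2L`: ratio `(2L/(L - c))³ ≤ (8/3)³ = 512/27`
  have hcL : k + 2 < L := by omega
  have e := cube_extension_sharp hS hT (c := k + 2) (L := L) (L' := L') (by omega) hcL hLL'
  have hLr : (0 : ℝ) < (L : ℝ) - ((k + 2 : ℕ) : ℝ) := by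
    have : ((k + 2 : ℕ) : ℝ) < (L : ℝ) := by exact_mod_cast hcL
    linarith
  have hq : (L' : ℝ) / ((L : ℝ) - ((k + 2 : ℕ) : ℝ)) ≤ 8 / 3 := by
    rw [div_le_iff₀ hLr, hL'def]
    have h4k' : (4 : ℝ) * ((k + 2 : ℕ) : ℝ) ≤ (L : ℝ) := by exact_mod_cast h4k
    push_cast at h4k' ⊢
    linarith
  have hq0 : 0 ≤ (L' : ℝ) / ((L : ℝ) - ((k + 2 : ℕ) : ℝ)) := div_nonneg (by positivity) hLr.le
  have hq3 : ((L' : ℝ) / ((L : ℝ) - ((k + 2 : ℕ) : ℝ))) ^ 3 ≤ 512 / 27 := by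
    calc ((L' : ℝ) / ((L : ℝ) - ((k + 2 : ℕ) : ℝ))) ^ 3 ≤ (8 / 3 : ℝ) ^ 3 := pow_le_pow_left₀ hq0 hq 3
      _ = 512 / 27 := by norm_num
  have hY' : Yfun (Z L' L' L') (k + 2) ≤ 512 / 27 * Yfun (Z L L L) (k + 2) := by
    have e' : Yfun (Z L' L' L') (k + 2) ≤ ((L' : ℝ) / ((L : ℝ) - ((k + 2 : ℕ) : ℝ))) ^ 3 * Yfun (Z L L L) (k + 2) := by
      simpa using e
    exact e'.trans (mul_le_mul_of_nonneg_right hq3 hy0)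
  have hx't : exc (Z L' L' L') (k + 2) ≤ Real.exp (9.64 * δ) - 1 := by
    rw [exc_eq_exp_Yfun hz' k]
    have : Yfun (Z L' L' L') (k + 2) ≤ 9.64 * δ := by
      have : 512 / 27 * Yfun (Z L L L) (k + 2) ≤ 512 / 27 * (9.64 / (512 / 27) * δ) :=
        mul_le_mul_of_nonneg_left hy (by norm_num)
      linarith
    linarith [Real.exp_le_exp.2 this]
  have hx't0 : 0 ≤ exc (Z L' L' L') (k + 2) := exc_nonneg hz' k
  have hx'T : exc (Z L' L' L') (k' + 2) ≤ exc (Z L' L' L') (k + 2) ^ 2 :=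
    calc exc (Z L' L' L') (k' + 2) ≤ exc (Z L' L' L') (2 * k + 2 + 2) := exc_antitone hz' hkk'
      _ = exc (Z L' L' L') (2 * (k + 2)) := by ring_nf
      _ ≤ exc (Z L' L' L') (k + 2) ^ 2 := exc_two_mul_le_sq hz' k
  have hu : Real.exp (9.64 * δ) - 1 ≤ 9.64 * δ * Real.exp (9.64 * δ) :=
    Literature.Analysis.ODE.exp_sub_one_le_mul_exp _
  have hE1 : 1 ≤ Real.exp (9.64 * δ) := Real.one_le_exp (by positivity)
  have hu0 : 0 ≤ Real.exp (9.64 * δ) - 1 := by linarith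
  calc δ' ≤ 2 * exc (Z L' L' L') (k' + 2) := hδ'x
    _ ≤ 2 * exc (Z L' L' L') (k + 2) ^ 2 := by linarith [hx'T]
    _ ≤ 2 * (Real.exp (9.64 * δ) - 1) ^ 2 := by gcongr
    _ ≤ 2 * (9.64 * δ * Real.exp (9.64 * δ)) ^ 2 := by gcongr

/-- numerical heart: `0 ≤ δ ≤ u ≤ 2⁻⁸ ⇒ 2 (9.64 δ e^{9.64 δ})² ≤ 201 u²`. -/
theorem sq_step8 {δ u : ℝ} (h0 : 0 ≤ δ) (hu : δ ≤ u) (hu8 : u ≤ 1 / 2 ^ 8) :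
    2 * (9.64 * δ * Real.exp (9.64 * δ)) ^ 2 ≤ 201 * u ^ 2 := by
  set E := Real.exp (9.64 * δ) with hEdef
  have hE0 : 0 < E := Real.exp_pos _
  have hEm : E * (1 - 9.64 * δ) ≤ 1 := by
    have h1 : 1 - 9.64 * δ ≤ Real.exp (-(9.64 * δ)) := by
      have := Real.one_sub_le_exp_neg (9.64 * δ); simpa using this
    calc E * (1 - 9.64 * δ) ≤ E * Real.exp (-(9.64 * δ)) := mul_le_mul_of_nonneg_left h1 hE0.le
      _ = 1 := by rw [hEdef, ← Real.exp_add]; simp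
  have ha0 : 0 ≤ 9.64 * δ * E := by positivity
  have hm0 : (1 : ℝ) - 9.64 / 2 ^ 8 ≤ 1 - 9.64 * δ := by nlinarith
  have hA : 9.64 * δ * E * (1 - 9.64 / 2 ^ 8) ≤ 9.64 * u := by
    have h1 : 9.64 * δ * E * (1 - 9.64 / 2 ^ 8) ≤ 9.64 * δ * E * (1 - 9.64 * δ) :=
      mul_le_mul_of_nonneg_left hm0 ha0
    have h2 : 9.64 * δ * E * (1 - 9.64 * δ) = 9.64 * δ * (E * (1 - 9.64 * δ)) := by ring
    have h3 : 9.64 * δ * (E * (1 - 9.64 * δ)) ≤ 9.64 * δ * 1 :=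
      mul_le_mul_of_nonneg_left hEm (by positivity)
    nlinarith
  have hB : (9.64 * δ * E * (1 - 9.64 / 2 ^ 8)) ^ 2 ≤ (9.64 * u) ^ 2 := by
    have hl : 0 ≤ 9.64 * δ * E * (1 - 9.64 / 2 ^ 8) := by positivity
    exact pow_le_pow_left₀ hl hA 2
  have hC : (9.64 * δ * E) ^ 2 * (1 - 9.64 / 2 ^ 8) ^ 2 ≤ (9.64 * u) ^ 2 := by
    have : (9.64 * δ * E * (1 - 9.64 / 2 ^ 8)) ^ 2 = (9.64 * δ * E) ^ 2 * (1 - 9.64 / 2 ^ 8) ^ 2 := by ring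
    linarith [this ▸ hB]
  have hsq0 : 0 ≤ (9.64 * δ * E) ^ 2 := by positivity
  have key : 2 * (9.64 * δ * E) ^ 2 * (1 - 9.64 / 2 ^ 8) ^ 2 ≤ 2 * (9.64 * u) ^ 2 := by nlinarith
  have hm2 : (2 : ℝ) * 9.64 ^ 2 ≤ 201 * (1 - 9.64 / 2 ^ 8) ^ 2 := by norm_num
  nlinarith [key, hm2, hsq0, sq_nonneg u]

/-- One exact doubling below `2⁻⁸`: `boxDefect Z L ≤ u ≤ 2⁻⁸ ⇒ boxDefect Z (2L) ≤ 201 u²` (no volume bounds). -/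
theorem basin_step8 (hS : IsAxisSymmetric Z) (hT : IsTracePositive Z)
    (L : ℕ) (hL : 8 ≤ L) {u : ℝ} (hu : boxDefect Z L ≤ u) (hu8 : u ≤ 1 / 2 ^ 8) :
    boxDefect Z (2 * L) ≤ 201 * u ^ 2 :=
  (defectSquaring_double_sharp8 hS hT L hL (hu.trans hu8)).trans
    (sq_step8 (boxDefect_nonneg_of_le hT L hL) hu hu8)

end Rung8

/-- **PROVED RUNG 2⁻⁸**: `AbstractBasin (1/2^8) (1/2^9)` — two exact doublings take a `2⁻⁸`-pure box (`L ≥ 8`) of ANY axis-symmetric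
trace-positive family to a `2⁻⁹`-pure box of side `4L` (`201·2⁻¹⁶ ≤ 2⁻⁸`, then `201³·2⁻³² ≤ 2⁻⁹`). -/
theorem abstractBasin_two_pow_8 : AbstractBasin (1 / 2 ^ 8) (1 / 2 ^ 9) := by
  intro Z hS hT _hV L hL hδ
  have h1 := basin_step8 hS hT L hL hδ le_rfl
  have h2 := basin_step8 hS hT (2 * L) (by omega) h1 (by norm_num)
  exact ⟨2 * (2 * L), by omega, h2.trans (by norm_num)⟩

/-- `AbstractBasin (1/2^8) epsStar`: compose with the landed rung `abstractBasin_two_pow_9`. -/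
theorem abstractBasin_two_pow_8_epsStar : AbstractBasin (1 / 2 ^ 8) epsStar :=
  abstractBasin_trans abstractBasin_two_pow_8 abstractBasin_two_pow_9

/-- **The bill with the seed at ONE tolerance `2⁻⁸` at ONE scale**: `ColdExitAt (1/2^8) → AFToColdPressure → IRnsc → IR`. -/
theorem IR_of_exitAt8 (hE : ColdExitAt (1 / 2 ^ 8)) (hX : AFToColdPressure) (hN : IRnsc) :
    Summit.QuantumFields.YangMills.Theses.BalabanLadder.IR :=
  IR_of_exitAt9 (coldExitAt_of_abstractBasin hE abstractBasin_two_pow_8) hX hN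

/-- Monotone packaging: any tolerance `θ ≤ 2⁻⁸` at one scale suffices. -/
theorem IR_of_exitAt_le8 {θ : ℝ} (hθ : θ ≤ 1 / 2 ^ 8) (hE : ColdExitAt θ) (hX : AFToColdPressure) (hN : IRnsc) :
    Summit.QuantumFields.YangMills.Theses.BalabanLadder.IR :=
  IR_of_exitAt8 (coldExitAt_mono hθ hE) hX hN

end Summit.QuantumFields.YangMills.Cruxes.IR.BasinRung

end
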